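import Literature.NumberTheory.GaloisCohomology.PoitouTateTwoRealPlacesSurjectiveHolds
import HarnessLib

/-!
# K4 `SignedControlAtTwo`, line `eulerchar` (skeleton v12): stub 4 `stub_poitouTateTwoRealRat` is a theorem

Crux `stmt-BirchSwinnertonDyer-20309` (`Summit.BirchSwinnertonDyer.BirchSwinnertonDyer.Theses.ThetaPartnerAtTwo.SignedControlAtTwo`,
also wanted by `ResidualThetaTransportAtTwo`), registered skeleton `Cruxes/SignedControlAtTwo/Lines/eulerchar.lean`
(sha16 `d717d3b34c614243`, four stubs = four generic Poitou–Tate named facts over `ℚ`).  Its fourth stub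

  `stub_poitouTateTwoRealRat : Literature.NumberTheory.GaloisCohomology.poitouTate_two_realPlaces_surjective ℚ`

(Milne, *ADT* I Cor. 4.16: `H²(ℚ, M) → H²(ℝ, M)` is surjective for every finite discrete `Γ_ℚ`-module
`M`) is discharged here VERBATIM by the tree's proof of the fact for every number field,
`Literature.NumberTheory.GaloisCohomology.poitouTate_two_realPlaces_surjective_holds`
(`GaloisCohomology/PoitouTateTwoRealPlacesSurjectiveHolds.lean`: carry cocycle of a Kummer sign character,
no class field theory).  The lead replaces the `sorry` of `stub_poitouTateTwoRealRat` in the skeleton by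
`Summit.BirchSwinnertonDyer.BirchSwinnertonDyer.Theorems.SignedEC.PoitouTateReal.stub_poitouTateTwoRealRat`;
the residue of K4 becomes the three class-field-theoretic facts `poitouTate_selmerStructure_duality ℚ`,
`poitouTate_sha_tateDual ℚ`, `poitouTate_three_realPlaces_injective ℚ`.

BSD is not proved by this file; it removes one of four named-fact inputs of one crux.
-/

set_option linter.dupNamespace false

namespace Summit.BirchSwinnertonDyer.BirchSwinnertonDyer.Theorems.SignedEC.PoitouTateReal

/-- **Stub 4 of K4 line `eulerchar` v12, as a theorem**: `H²(ℚ, M) → H²(ℝ, M)` is surjective for every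
finite discrete `Γ_ℚ`-module `M` — the named fact `poitouTate_two_realPlaces_surjective ℚ` (Milne, *ADT*
I Cor. 4.16), by `poitouTate_two_realPlaces_surjective_holds`. [cite: MilneADT2006, Ch. I, Cor. 4.16 (p. 62)] -/
theorem stub_poitouTateTwoRealRat :
    Literature.NumberTheory.GaloisCohomology.poitouTate_two_realPlaces_surjective ℚ :=
  Literature.NumberTheory.GaloisCohomology.poitouTate_two_realPlaces_surjective_holds ℚ

/-- The same for every number field `K` (re-export under the K4 namespace, for the sibling consumers
over totally real fields, e.g. `SignedEC.ShaTwo.forall_mem_shaTwo_primary_eq_zero_of_isTotallyReal`).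
[cite: MilneADT2006, Ch. I, Cor. 4.16 (p. 62)] -/
theorem poitouTate_two_realPlaces_surjective_numberField (K : Type) [Field K] [NumberField K] :
    Literature.NumberTheory.GaloisCohomology.poitouTate_two_realPlaces_surjective K :=
  Literature.NumberTheory.GaloisCohomology.poitouTate_two_realPlaces_surjective_holds K

end Summit.BirchSwinnertonDyer.BirchSwinnertonDyer.Theorems.SignedEC.PoitouTateReal
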